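import Mathlib.Algebra.BigOperators.GroupWithZero.Finset
import Mathlib.Algebra.Field.Basic
import Mathlib.Algebra.GroupWithZero.Units.Lemmas
import Mathlib.Algebra.Group.Int.Defs
import Mathlib.Data.Fintype.Card
import Mathlib.Data.Finset.Powerset
import Mathlib.Data.Finset.Sort
import Mathlib.Algebra.BigOperators.Ring.Finset
import Mathlib.Algebra.Order.BigOperators.Group.Finset
import HarnessLib

/-!
# Subadditivity of the multiplicative rank in towers (den Besten, Lemma 7.1.19, inequality form)

Topic `Literature/ModelTheory/ExponentialFields`.  M. den Besten, *Wilkie's Theorem and the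
Uniform Real Schanuel Conjecture* (MSc thesis, Utrecht 2016), §7.1: the valuative dimension
`valdim_k(K)` of an extension of models is the `ℚ`-dimension of the value group `V(K)` over the
image of `k` (Definitions 7.1.14–7.1.18), and

> **Lemma 7.1.19.** Let `k₀ ⊆ k₁ ⊆ K ⊨ T_O`. Then `valdim_{k₀}(K) = valdim_{k₀}(k₁) + valdim_{k₁}(K)`.

which reduces the valuation inequality (Theorem 7.1.23) to extensions of dimension one.  The
files of this tree around `Wilkie1996Lemma93Valuation.lean` avoid value groups and express
"valuative rank at most `r`" concretely: *any `r + 1` (non-zero) elements are multiplicatively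
dependent modulo a set `T`* — there is a non-zero integer vector `e` with `∏ xᵢ ^ eᵢ ∈ T`
(`MulDependent T x`), `T` being "`k^× ·` valuation units".  This file proves the inequality
`≤` of Lemma 7.1.19 in that concrete language, for an arbitrary field and arbitrary sets:

* `MulDependent T x` (definition);
* `mulDependent_of_tower`: if every `r + 1` elements of `T₁` are dependent modulo `T₀`, and every
  `s + 1` non-zero elements of `D` are dependent modulo `T₁`, then every `r + s + 1` non-zero
  elements of `D` are dependent modulo `T₀`.

The proof is the exchange argument behind the additivity of ranks: take a maximal subfamily
independent modulo `T₁` (at most `s` elements); each of the `≥ r + 1` remaining elements has a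
non-zero power in `T₁` times a monomial in the independent ones; a dependence modulo `T₀` among
`r + 1` of these elements of `T₁` expands to a non-trivial dependence of the original family.
No hypothesis on `T₀`, `T₁`, `D` is needed.  Nothing here is a named fact.

## References

* [DenBesten2016] M. den Besten, *Wilkie's Theorem and the Uniform Real Schanuel Conjecture*,
  MSc thesis, Utrecht 2016, Definitions 7.1.14–7.1.18, Lemma 7.1.19, Theorem 7.1.23.
-/

open Finset

namespace Literature.ModelTheory.ExponentialFields

variable {K : Type*} [Field K]

/-- **Multiplicative dependence modulo a set**: the finite family `x` is dependent modulo `T` if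
some non-trivial monomial `∏ xᵢ ^ eᵢ` (`e ≠ 0` an integer vector) lies in `T` (the concrete form
of "`ℚ`-linearly dependent valuations over `ν[k]`", den Besten 2016, Definition 7.1.18, used in
`Wilkie1996Lemma93Valuation.lean`). [cite: DenBesten2016, Definition 7.1.18] -/
def MulDependent (T : Set K) {ι : Type*} [Fintype ι] (x : ι → K) : Prop :=
  ∃ e : ι → ℤ, e ≠ 0 ∧ ∏ i, x i ^ e i ∈ T

/-- Unfolding lemma for `MulDependent`. [cite: DenBesten2016, Definition 7.1.18] -/
theorem mulDependent_iff {T : Set K} {ι : Type*} [Fintype ι] {x : ι → K} :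
    MulDependent T x ↔ ∃ e : ι → ℤ, e ≠ 0 ∧ ∏ i, x i ^ e i ∈ T :=
  Iff.rfl

/-- Integer powers of a non-zero element turn sums of exponents into products. [folklore] -/
theorem zpow_finset_sum {ι : Type*} (s : Finset ι) {a : K} (ha : a ≠ 0) (f : ι → ℤ) :
    a ^ (∑ i ∈ s, f i) = ∏ i ∈ s, a ^ f i := by
  classical
  induction s using Finset.induction_on with
  | empty => simp
  | insert j s hj ih => rw [sum_insert hj, prod_insert hj, zpow_add₀ ha, ih]

/-- **Dependence transported along an injection**: a dependence of the subfamily `x ∘ φ` is a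
dependence of `x` supported on the range of `φ` (extend the exponent vector by zero). [folklore] -/
theorem exists_extend_of_mulDependent_comp {T : Set K} {ι κ : Type*} [Fintype ι] [Fintype κ]
    [DecidableEq ι] {x : ι → K} {φ : κ → ι} (hφ : Function.Injective φ)
    (h : MulDependent T (x ∘ φ)) :
    ∃ e : ι → ℤ, e ≠ 0 ∧ (∀ i, (∀ l, φ l ≠ i) → e i = 0) ∧ ∏ i, x i ^ e i ∈ T := by
  classical
  obtain ⟨e', he', hprod⟩ := h
  refine ⟨Function.extend φ e' 0, ?_, fun i hi => ?_, ?_⟩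
  · intro h0
    apply he'
    funext l
    have := congrFun h0 (φ l)
    rwa [hφ.extend_apply] at this
  · rw [Function.extend_apply' _ _ _ (fun ⟨l, hl⟩ => hi l hl), Pi.zero_apply]
  · have hprod' : ∏ i, x i ^ Function.extend φ e' 0 i = ∏ l, (x ∘ φ) l ^ e' l := by
      rw [← Finset.prod_subset (Finset.subset_univ (Finset.univ.image φ))]
      · rw [Finset.prod_image fun a _ b _ hab => hφ hab]
        exact Finset.prod_congr rfl fun l _ => by rw [hφ.extend_apply]; rfl
      · intro i _ hi
        have hi' : ¬ ∃ l, φ l = i := by simpa [Finset.mem_image] using hi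
        rw [Function.extend_apply' _ _ _ hi', Pi.zero_apply, zpow_zero]
    rw [hprod']
    exact hprod

/-- **Subadditivity of the multiplicative rank in a tower** (the inequality
`valdim_{k₀}(K) ≤ valdim_{k₀}(k₁) + valdim_{k₁}(K)` of den Besten 2016, Lemma 7.1.19, in the
concrete language of multiplicative dependence): if every `r + 1` elements of `T₁` are dependent
modulo `T₀` and every `s + 1` non-zero elements of `D` are dependent modulo `T₁`, then every
`r + s + 1` non-zero elements of `D` are dependent modulo `T₀`. [cite: DenBesten2016, Lemma 7.1.19] -/
theorem mulDependent_of_tower {r s : ℕ} {D T₀ T₁ : Set K}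
    (h₁ : ∀ t : Fin (r + 1) → K, (∀ l, t l ∈ T₁) → MulDependent T₀ t)
    (h₂ : ∀ y : Fin (s + 1) → K, (∀ l, y l ∈ D) → (∀ l, y l ≠ 0) → MulDependent T₁ y)
    (x : Fin (r + s + 1) → K) (hxD : ∀ m, x m ∈ D) (hx0 : ∀ m, x m ≠ 0) :
    MulDependent T₀ x := by
  classical
  -- dependence modulo `T₁` supported on a set of indices
  set Dep : Finset (Fin (r + s + 1)) → Prop := fun I =>
    ∃ e : Fin (r + s + 1) → ℤ, (∀ m, m ∉ I → e m = 0) ∧ e ≠ 0 ∧ ∏ m, x m ^ e m ∈ T₁ with hDep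
  -- a maximal independent set of indices
  have hempty : ¬ Dep ∅ := by
    rintro ⟨e, hsupp, hne, -⟩
    exact hne (funext fun m => hsupp m (Finset.notMem_empty m))
  obtain ⟨I, hI, hImax⟩ := Finset.exists_max_image (Finset.univ.filter fun I => ¬ Dep I)
    Finset.card ⟨∅, Finset.mem_filter.2 ⟨Finset.mem_univ _, hempty⟩⟩
  rw [Finset.mem_filter] at hI
  have hIind : ¬ Dep I := hI.2
  have hmax : ∀ J : Finset (Fin (r + s + 1)), ¬ Dep J → J.card ≤ I.card := fun J hJ =>
    hImax J (Finset.mem_filter.2 ⟨Finset.mem_univ _, hJ⟩)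
  -- `|I| ≤ s`: any `s + 1` indices carry a dependence modulo `T₁`
  have hIcard : I.card ≤ s := by
    by_contra hlt
    push Not at hlt
    -- an injection `Fin (s + 1) ↪ I`
    have hle : s + 1 ≤ I.card := hlt
    let φ : Fin (s + 1) → Fin (r + s + 1) := fun l => I.orderEmbOfFin rfl (Fin.castLE hle l)
    have hφmem : ∀ l, φ l ∈ I := fun l => Finset.orderEmbOfFin_mem I rfl _
    have hφinj : Function.Injective φ := fun a b hab =>
      Fin.castLE_injective hle ((I.orderEmbOfFin rfl).injective hab)
    obtain ⟨e, hne, hsupp, hprod⟩ := exists_extend_of_mulDependent_comp hφinj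
      (h₂ (x ∘ φ) (fun l => hxD _) (fun l => hx0 _))
    exact hIind ⟨e, fun m hm => hsupp m fun l hl => hm (hl ▸ hφmem l), hne, hprod⟩
  -- each index outside `I` carries a dependence modulo `T₁` with non-zero exponent there
  have hout : ∀ j, j ∉ I → ∃ e : Fin (r + s + 1) → ℤ,
      (∀ m, m ∉ insert j I → e m = 0) ∧ e j ≠ 0 ∧
      ∏ m, x m ^ e m ∈ T₁ := by
    intro j hj
    have hdep : Dep (insert j I) := by
      by_contra hnd
      have := hmax _ hnd
      rw [Finset.card_insert_of_notMem hj] at this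
      omega
    obtain ⟨e, hsupp, hne, hprod⟩ := hdep
    refine ⟨e, hsupp, fun hj0 => hIind ⟨e, fun m hm => ?_, hne, hprod⟩, hprod⟩
    by_cases hmj : m = j
    · rw [hmj]; exact hj0
    · exact hsupp m fun h => (Finset.mem_insert.1 h).elim hmj hm
  choose! e he_supp he_ne he_prod using hout
  -- `r + 1` indices outside `I`
  have hcompl : r + 1 ≤ (Finset.univ \ I).card := by
    rw [Finset.card_univ_sdiff, Fintype.card_fin]
    omega
  let ψ : Fin (r + 1) → Fin (r + s + 1) := fun l =>
    (Finset.univ \ I).orderEmbOfFin rfl (Fin.castLE hcompl l)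
  have hψmem : ∀ l, ψ l ∉ I := fun l => by
    have h := Finset.orderEmbOfFin_mem (Finset.univ \ I) rfl (Fin.castLE hcompl l)
    exact (Finset.mem_sdiff.1 h).2
  have hψinj : Function.Injective ψ := fun a b hab =>
    Fin.castLE_injective hcompl (((Finset.univ \ I).orderEmbOfFin rfl).injective hab)
  -- the elements `t l = ∏ x ^ e (ψ l)` of `T₁` are dependent modulo `T₀`
  set t : Fin (r + 1) → K := fun l => ∏ m, x m ^ e (ψ l) m with ht
  obtain ⟨c, hc, hcprod⟩ := h₁ t fun l => he_prod _ (hψmem l)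
  -- the total exponent vector
  refine ⟨fun m => ∑ l, c l * e (ψ l) m, ?_, ?_⟩
  · -- non-triviality: at `ψ l₀` with `c l₀ ≠ 0` only the `l₀` term survives
    intro hzero
    obtain ⟨l₀, hl₀⟩ : ∃ l₀, c l₀ ≠ 0 := by
      by_contra hall
      push Not at hall
      exact hc (funext hall)
    have hsum : (∑ l, c l * e (ψ l) (ψ l₀)) = c l₀ * e (ψ l₀) (ψ l₀) := by
      refine Finset.sum_eq_single l₀ (fun l _ hl => ?_) (fun h => (h (Finset.mem_univ _)).elim)
      have hne : ψ l₀ ∉ insert (ψ l) I := by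
        rw [Finset.mem_insert, not_or]
        exact ⟨fun h => hl (hψinj h.symm), hψmem l₀⟩
      rw [he_supp _ (hψmem l) _ hne, mul_zero]
    have h0 := congrFun hzero (ψ l₀)
    simp only [Pi.zero_apply] at h0
    rw [hsum] at h0
    exact (mul_ne_zero hl₀ (he_ne _ (hψmem l₀))) h0
  · -- the monomial is `∏ t l ^ c l ∈ T₀`
    have hcalc : ∏ m, x m ^ (∑ l, c l * e (ψ l) m) = ∏ l, t l ^ c l :=
      calc ∏ m, x m ^ (∑ l, c l * e (ψ l) m)
          = ∏ m, ∏ l, x m ^ (c l * e (ψ l) m) :=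
            Finset.prod_congr rfl fun m _ => zpow_finset_sum _ (hx0 m) _
        _ = ∏ l, ∏ m, x m ^ (c l * e (ψ l) m) := Finset.prod_comm
        _ = ∏ l, ∏ m, (x m ^ e (ψ l) m) ^ c l := by
            refine Finset.prod_congr rfl fun l _ => Finset.prod_congr rfl fun m _ => ?_
            rw [mul_comm, zpow_mul]
        _ = ∏ l, t l ^ c l := by
            refine Finset.prod_congr rfl fun l _ => ?_
            rw [ht, Finset.prod_zpow]
    rw [hcalc]
    exact hcprod

end Literature.ModelTheory.ExponentialFields
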